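import Mathlib
import HarnessLib

/-!
# Stub `stub_mourreThresholdLAP` — F0: the modified Gronwall lemma (ABG Lemma 7.A.1, θ = 1/2)

Item `stmt-AtomisticToContinuum-12594` (crux `MourreDissolution` of route `EmbeddedDrudeMourre`,
sub-problem `FouriersLaw`), line `separable-vertex-faddeev-pair-sector`, stub S6
`stub_mourreThresholdLAP` (Mourre's limiting absorption principle), helper F0 of the proof map:
the Gronwall-type lemma that closes Mourre's differential inequality
`|F'_ε| ≤ η(ε) + φ(ε) |F_ε|^{1/2} + ψ(ε) |F_ε|` on `(0, ε₀]` into a bound on `|F_ε|` that is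
uniform in `ε` (and, in the application, in the spectral parameter `z`). Pure real analysis,
Mathlib only.

Contents:

* `le_mul_exp_of_le_add_intervalIntegral`: the linear Gronwall inequality in integral form,
  backward in time, with a merely integrable kernel `K ≥ 0`:
  `u s ≤ C + ∫_s^b K u ⟹ u s ≤ C exp (∫_s^b K)`. The proof is the integrating-factor argument
  run on the absolutely continuous function `s ↦ (C + ∫_s^b K u) exp (-∫_s^b K)` with Mathlib's
  FTC for absolutely continuous functions and the interval Lebesgue differentiation theorem;
  `absolutelyContinuousOnInterval_comp_of_lipschitzOnWith` supplies absolute continuity of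
  `exp ∘ (AC function)`.
* `le_of_le_add_intervalIntegral_sqrt`: the square-root Gronwall lemma in integral form,
  `u s ≤ D + ∫_s^b (η + φ √u + ψ u) ⟹ u s ≤ 2 (D + ∫_s^b η + (∫_s^b φ)²) exp (∫_s^b ψ)`
  (ABG (7.3.11), weak form of Lemma 7.A.1 with θ = 1/2; our constant 2 replaces ABG's sharp one):
  linearise `φ √u ≤ (c/2) φ + (φ / 2c) u`, apply the linear lemma, optimise the scale `c = ∫_s^b φ`.
* `norm_le_of_norm_deriv_le_sqrt`: the differential form for `F : ℝ → E`, via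
  `‖F b - F s‖ ≤ ∫_s^b (bound on ‖F'‖)`; `norm_le_sqrt_gronwall` (headline, binders explicit, set
  integrals over `Set.Ioc ε ε₀`) and `norm_le_sqrt_gronwall_uniform` (the `ε`-independent bound
  consumed by the differential-inequality step F4 of the LAP).
Not here: ABG's optimal constant, the case `θ ≠ 1/2`, anything about operators.
-/

noncomputable section

open MeasureTheory Set Filter Topology intervalIntegral
open scoped NNReal

namespace Summit.AtomisticToContinuum.FouriersLaw.Theorems.MourreDissolution

/-! ## §1. Absolute continuity of `g ∘ f` for Lipschitz `g` -/

/-- A Lipschitz function of an absolutely continuous real function is absolutely continuous: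
if `g` is `L`-Lipschitz on a set `s` containing `f '' [[a, b]]` and `f` is absolutely continuous
on `[[a, b]]`, then so is `g ∘ f` (immediate from the definition: the sums of oscillations of
`g ∘ f` are at most `L` times those of `f`). [folklore] -/
theorem absolutelyContinuousOnInterval_comp_of_lipschitzOnWith {f g : ℝ → ℝ} {L : ℝ≥0}
    {s : Set ℝ} {a b : ℝ} (hg : LipschitzOnWith L g s) (hf : AbsolutelyContinuousOnInterval f a b)
    (hs : MapsTo f (uIcc a b) s) : AbsolutelyContinuousOnInterval (g ∘ f) a b := by
  unfold AbsolutelyContinuousOnInterval at hf ⊢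
  refine squeeze_zero' (Eventually.of_forall fun _ => Finset.sum_nonneg fun _ _ => dist_nonneg)
    ?_ (by simpa using hf.const_mul (L : ℝ))
  rw [eventually_inf_principal]
  filter_upwards with E hE
  rw [Finset.mul_sum]
  refine Finset.sum_le_sum fun i hi => ?_
  simp only [AbsolutelyContinuousOnInterval.disjWithin, mem_setOf_eq] at hE
  exact hg.dist_le_mul _ (hs (hE.1 i hi).1) _ (hs (hE.1 i hi).2)

/-! ## §2. The linear Gronwall lemma in integral form (integrable kernel, backward in time) -/

/-- **Linear Gronwall inequality in integral form, backward in time, integrable kernel.**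
If `u` is continuous on `[a, b]`, `K ≥ 0` is integrable on `[a, b]`, `C` is a real constant and
`u s ≤ C + ∫_s^b K u` for all `s ∈ [a, b]`, then `u s ≤ C · exp (∫_s^b K)` on `[a, b]`.
Proof: the function `Q s := (C + ∫_s^b K u) · exp (-∫_s^b K)` is absolutely continuous on
`[a, b]` with a.e. derivative `K exp(-∫_s^b K) (C + ∫_s^b K u - u) ≥ 0` (interval Lebesgue
differentiation theorem), hence `Q s ≤ Q b = C` by the fundamental theorem of calculus for
absolutely continuous functions. [folklore] -/
theorem le_mul_exp_of_le_add_intervalIntegral {u K : ℝ → ℝ} {a b C : ℝ} (hab : a ≤ b)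
    (hu : ContinuousOn u (Icc a b)) (hK : IntegrableOn K (Icc a b))
    (hK0 : ∀ t ∈ Icc a b, 0 ≤ K t)
    (hle : ∀ s ∈ Icc a b, u s ≤ C + ∫ τ in s..b, K τ * u τ) :
    ∀ s ∈ Icc a b, u s ≤ C * Real.exp (∫ τ in s..b, K τ) := by
  have hKi : IntervalIntegrable K volume a b :=
    (intervalIntegrable_iff_integrableOn_Icc_of_le hab).2 hK
  have hKui : IntervalIntegrable (fun τ => K τ * u τ) volume a b :=
    (intervalIntegrable_iff_integrableOn_Icc_of_le hab).2 (hK.mul_continuousOn hu isCompact_Icc)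
  -- primitives from `b`
  set P : ℝ → ℝ := fun s => ∫ τ in b..s, K τ with hP_def
  set R : ℝ → ℝ := fun s => ∫ τ in b..s, K τ * u τ with hR_def
  have hbmem : b ∈ uIcc a b := right_mem_uIcc
  have hP_ac : AbsolutelyContinuousOnInterval P a b :=
    hKi.absolutelyContinuousOnInterval_intervalIntegral hbmem
  have hR_ac : AbsolutelyContinuousOnInterval R a b :=
    hKui.absolutelyContinuousOnInterval_intervalIntegral hbmem
  -- `P ≤ 0` on `[a, b]`
  have hP_nonpos : ∀ s ∈ Icc a b, P s ≤ 0 := by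
    intro s hs
    have h0 : 0 ≤ ∫ τ in s..b, K τ :=
      integral_nonneg hs.2 fun τ hτ => hK0 τ ⟨hs.1.trans hτ.1, hτ.2⟩
    simp only [hP_def]
    rw [integral_symm s b]
    linarith
  -- `exp ∘ P` is absolutely continuous (`exp` is `1`-Lipschitz on `(-∞, 0]`)
  have hexp_lip : LipschitzOnWith 1 Real.exp (Iic 0) := by
    refine (convex_Iic 0).lipschitzOnWith_of_nnnorm_deriv_le
      (fun x _ => Real.differentiableAt_exp) ?_
    intro x hx
    rw [Real.deriv_exp, ← NNReal.coe_le_coe, coe_nnnorm, Real.norm_eq_abs,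
      abs_of_pos (Real.exp_pos x), NNReal.coe_one]
    exact Real.exp_le_one_iff.2 hx
  have hE_ac : AbsolutelyContinuousOnInterval (Real.exp ∘ P) a b :=
    absolutelyContinuousOnInterval_comp_of_lipschitzOnWith hexp_lip hP_ac
      (fun s hs => hP_nonpos s (by rwa [uIcc_of_le hab] at hs))
  -- `Q := (C - R) * exp P`
  set Q : ℝ → ℝ := fun s => (C - R s) * Real.exp (P s) with hQ_def
  have hQ_ac : AbsolutelyContinuousOnInterval Q a b := by
    have hc : AbsolutelyContinuousOnInterval (fun _ : ℝ => C) a b :=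
      ((LipschitzWith.const C).lipschitzOnWith).absolutelyContinuousOnInterval
    exact (hc.sub hR_ac).mul hE_ac
  -- the a.e. derivative of `Q` is nonnegative
  have hQ' : ∀ᵐ x, x ∈ uIcc a b → 0 ≤ deriv Q x := by
    filter_upwards [hKi.ae_hasDerivAt_integral, hKui.ae_hasDerivAt_integral] with x hx1 hx2 hx
    have hPx : HasDerivAt P (K x) x := hx1 hx b hbmem
    have hRx : HasDerivAt R (K x * u x) x := hx2 hx b hbmem
    have hEx : HasDerivAt (fun s => Real.exp (P s)) (Real.exp (P x) * K x) x := hPx.exp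
    have hQx : HasDerivAt Q
        ((0 - K x * u x) * Real.exp (P x) + (C - R x) * (Real.exp (P x) * K x)) x :=
      ((hasDerivAt_const x C).sub hRx).mul hEx
    rw [uIcc_of_le hab] at hx; rw [hQx.deriv]
    have hux : u x ≤ C - R x := by
      have := hle x hx
      rwa [integral_symm b x, ← sub_eq_add_neg] at this
    have key : (0 - K x * u x) * Real.exp (P x) + (C - R x) * (Real.exp (P x) * K x) =
        K x * Real.exp (P x) * (C - R x - u x) := by ring
    rw [key]
    exact mul_nonneg (mul_nonneg (hK0 x hx) (Real.exp_pos _).le) (by linarith)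
  -- conclude by the fundamental theorem of calculus for `Q` on `[s, b]`
  intro s hs
  have hsub : uIcc s b ⊆ uIcc a b := by
    rw [uIcc_of_le hs.2, uIcc_of_le hab]
    exact Icc_subset_Icc_left hs.1
  have hFTC := (hQ_ac.mono hsub).integral_deriv_eq_sub
  have hint : 0 ≤ ∫ x in s..b, deriv Q x := by
    apply integral_nonneg_of_ae_restrict hs.2
    rw [EventuallyLE, ae_restrict_iff' measurableSet_Icc]
    filter_upwards [hQ'] with x hx hxs
    exact hx (hsub (by rwa [uIcc_of_le hs.2]))
  have hQb : Q b = C := by simp [hQ_def, hP_def, hR_def]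
  have hQs : (C - R s) * Real.exp (P s) ≤ C := by change Q s ≤ C; linarith
  have hus : u s ≤ C - R s := by
    have := hle s hs
    rwa [integral_symm b s, ← sub_eq_add_neg] at this
  have h1 : C - R s ≤ C * Real.exp (∫ τ in s..b, K τ) := by
    rw [integral_symm b s, Real.exp_neg, le_mul_inv_iff₀ (Real.exp_pos _)]
    exact hQs
  exact hus.trans h1

/-! ## §3. The square-root Gronwall lemma in integral form -/

/-- Interval integrability on a subinterval `[s, t] ⊆ [a, b]` of a function integrable on
`[a, b]`. [folklore] -/
theorem intervalIntegrable_of_integrableOn_Icc {f : ℝ → ℝ} {a b s t : ℝ}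
    (hf : IntegrableOn f (Icc a b)) (hs : a ≤ s) (hst : s ≤ t) (ht : t ≤ b) :
    IntervalIntegrable f volume s t :=
  (intervalIntegrable_iff_integrableOn_Icc_of_le hst).2 (hf.mono_set (Icc_subset_Icc hs ht))

/-- The elementary inequality behind the linearisation of the square root:
`√x ≤ c/2 + x/(2c)` for `x ≥ 0`, `c > 0` (i.e. `(√x - c)² ≥ 0`). [folklore] -/
theorem sqrt_le_half_add_div {x c : ℝ} (hx : 0 ≤ x) (hc : 0 < c) :
    Real.sqrt x ≤ c / 2 + x / (2 * c) := by
  have hxx : Real.sqrt x ^ 2 = x := Real.sq_sqrt hx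
  rw [div_add_div _ _ two_ne_zero (by positivity), le_div_iff₀ (by positivity)]
  nlinarith [sq_nonneg (Real.sqrt x - c), Real.sqrt_nonneg x]

/-- The numerical inequality `exp (1/2) ≤ 2` (since `e < 2.72 < 4`). [folklore] -/
theorem exp_half_le_two : Real.exp (1 / 2 : ℝ) ≤ 2 := by
  have h1 : Real.exp (1 / 2 : ℝ) ^ 2 = Real.exp 1 := by
    rw [← Real.exp_nat_mul]; norm_num
  nlinarith [Real.exp_one_lt_d9, Real.exp_pos (1 / 2 : ℝ)]

/-- **Modified Gronwall lemma with a square root, integral form (backward in time).**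
Let `u ≥ 0` be continuous on `[a, b]`, `η, φ, ψ ≥ 0` integrable on `[a, b]`, `D` real, and
`u s ≤ D + ∫_s^b (η + φ √u + ψ u)` for all `s ∈ [a, b]`. Then for all `s ∈ [a, b]`,
`u s ≤ 2 (D + ∫_s^b η + (∫_s^b φ)²) · exp (∫_s^b ψ)`.
This is the weak form (7.3.11) of Lemma 7.A.1 (θ = 1/2) of Amrein–Boutet de Monvel–Georgescu
(with the constant `2` in place of the sharp one). Proof: linearise
`φ √u ≤ (c/2) φ + (φ/(2c)) u` (`sqrt_le_half_add_div`), apply the linear Gronwall lemma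
`le_mul_exp_of_le_add_intervalIntegral` on `[s, b]`, and choose the scale `c = ∫_s^b φ`, which
produces the factor `e^{1/2} ≤ 2`. [cite: AmreinBoutetdeMonvelGeorgescu1996, Lemma 7.A.1] -/
theorem le_of_le_add_intervalIntegral_sqrt {u η φ ψ : ℝ → ℝ} {a b D : ℝ} (hab : a ≤ b)
    (hu : ContinuousOn u (Icc a b)) (hu0 : ∀ t ∈ Icc a b, 0 ≤ u t)
    (hη : IntegrableOn η (Icc a b)) (hφ : IntegrableOn φ (Icc a b))
    (hψ : IntegrableOn ψ (Icc a b))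
    (hη0 : ∀ t ∈ Icc a b, 0 ≤ η t) (hφ0 : ∀ t ∈ Icc a b, 0 ≤ φ t)
    (hψ0 : ∀ t ∈ Icc a b, 0 ≤ ψ t)
    (hle : ∀ s ∈ Icc a b,
      u s ≤ D + ∫ τ in s..b, (η τ + φ τ * Real.sqrt (u τ) + ψ τ * u τ)) :
    ∀ s ∈ Icc a b, u s ≤ 2 * (D + (∫ τ in s..b, η τ) + (∫ τ in s..b, φ τ) ^ 2) *
      Real.exp (∫ τ in s..b, ψ τ) := by
  intro s₀ hs₀
  have hs₀b : s₀ ≤ b := hs₀.2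
  have hsub : Icc s₀ b ⊆ Icc a b := Icc_subset_Icc_left hs₀.1
  have hP₀ : 0 ≤ ∫ τ in s₀..b, φ τ := integral_nonneg hs₀b fun τ hτ => hφ0 τ (hsub hτ)
  have hD : 0 ≤ D := by
    have := hle b ⟨hab, le_rfl⟩
    rw [integral_same, add_zero] at this
    exact (hu0 b ⟨hab, le_rfl⟩).trans this
  have hΛ₀ : 0 ≤ D + ∫ τ in s₀..b, η τ :=
    add_nonneg hD (integral_nonneg hs₀b fun τ hτ => hη0 τ (hsub hτ))
  -- integrability of the products with the bounded continuous factors `u`, `√u`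
  have hφsu : IntegrableOn (fun τ => φ τ * Real.sqrt (u τ)) (Icc a b) :=
    hφ.mul_continuousOn hu.sqrt isCompact_Icc
  have hψu : IntegrableOn (fun τ => ψ τ * u τ) (Icc a b) := hψ.mul_continuousOn hu isCompact_Icc
  have hB : IntegrableOn (fun τ => η τ + φ τ * Real.sqrt (u τ) + ψ τ * u τ) (Icc a b) :=
    (hη.add hφsu).add hψu
  -- the bound for an arbitrary scale `c > 0`
  have key : ∀ c : ℝ, 0 < c → u s₀ ≤ (D + (∫ τ in s₀..b, η τ) + c / 2 * ∫ τ in s₀..b, φ τ) *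
      Real.exp ((∫ τ in s₀..b, ψ τ) + (∫ τ in s₀..b, φ τ) / (2 * c)) := by
    intro c hc
    have hKc : IntegrableOn (fun τ => ψ τ + φ τ / (2 * c)) (Icc a b) := hψ.add (hφ.div_const _)
    have hKc0 : ∀ t ∈ Icc s₀ b, 0 ≤ ψ t + φ t / (2 * c) := fun t ht =>
      add_nonneg (hψ0 t (hsub ht)) (div_nonneg (hφ0 t (hsub ht)) (by positivity))
    have hKcu : IntegrableOn (fun τ => (ψ τ + φ τ / (2 * c)) * u τ) (Icc a b) :=
      hKc.mul_continuousOn hu isCompact_Icc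
    have hηφ : IntegrableOn (fun τ => η τ + c / 2 * φ τ) (Icc a b) := hη.add (hφ.const_mul _)
    have hB' : IntegrableOn (fun τ => (η τ + c / 2 * φ τ) + (ψ τ + φ τ / (2 * c)) * u τ)
        (Icc a b) := hηφ.add hKcu
    -- the linearised integral inequality on `[s₀, b]`
    have hlin : ∀ s ∈ Icc s₀ b, u s ≤ (D + (∫ τ in s₀..b, η τ) + c / 2 * ∫ τ in s₀..b, φ τ) +
        ∫ τ in s..b, (ψ τ + φ τ / (2 * c)) * u τ := by
      intro s hs
      have hsb : s ≤ b := hs.2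
      have has : a ≤ s := hs₀.1.trans hs.1
      have hpt : ∀ τ ∈ Icc s b, η τ + φ τ * Real.sqrt (u τ) + ψ τ * u τ ≤
          (η τ + c / 2 * φ τ) + (ψ τ + φ τ / (2 * c)) * u τ := by
        intro τ hτ
        have hτ' : τ ∈ Icc a b := ⟨has.trans hτ.1, hτ.2⟩
        have h1 := mul_le_mul_of_nonneg_left (sqrt_le_half_add_div (hu0 τ hτ') hc) (hφ0 τ hτ')
        have h2 : φ τ * (c / 2 + u τ / (2 * c)) = c / 2 * φ τ + φ τ / (2 * c) * u τ := by ring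
        nlinarith [h1, h2]
      calc u s ≤ D + ∫ τ in s..b, (η τ + φ τ * Real.sqrt (u τ) + ψ τ * u τ) :=
            hle s ⟨has, hsb⟩
        _ ≤ D + ∫ τ in s..b, ((η τ + c / 2 * φ τ) + (ψ τ + φ τ / (2 * c)) * u τ) :=
            add_le_add le_rfl (integral_mono_on hsb
              (intervalIntegrable_of_integrableOn_Icc hB has hsb le_rfl)
              (intervalIntegrable_of_integrableOn_Icc hB' has hsb le_rfl) hpt)
        _ = D + ((∫ τ in s..b, (η τ + c / 2 * φ τ)) +
              ∫ τ in s..b, (ψ τ + φ τ / (2 * c)) * u τ) := by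
            rw [integral_add (intervalIntegrable_of_integrableOn_Icc hηφ has hsb le_rfl)
              (intervalIntegrable_of_integrableOn_Icc hKcu has hsb le_rfl)]
        _ ≤ D + ((∫ τ in s₀..b, (η τ + c / 2 * φ τ)) +
              ∫ τ in s..b, (ψ τ + φ τ / (2 * c)) * u τ) := by
            refine add_le_add le_rfl (add_le_add ?_ le_rfl)
            refine integral_mono_interval hs.1 hsb le_rfl ?_
              (intervalIntegrable_of_integrableOn_Icc hηφ hs₀.1 hs₀b le_rfl)
            refine ae_restrict_of_forall_mem measurableSet_Ioc fun τ hτ => ?_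
            have hτ' : τ ∈ Icc a b := hsub ⟨hτ.1.le, hτ.2⟩
            exact add_nonneg (hη0 τ hτ') (mul_nonneg (by positivity) (hφ0 τ hτ'))
        _ = (D + (∫ τ in s₀..b, η τ) + c / 2 * ∫ τ in s₀..b, φ τ) +
              ∫ τ in s..b, (ψ τ + φ τ / (2 * c)) * u τ := by
            rw [integral_add (intervalIntegrable_of_integrableOn_Icc hη hs₀.1 hs₀b le_rfl)
              ((intervalIntegrable_of_integrableOn_Icc hφ hs₀.1 hs₀b le_rfl).const_mul _),
              intervalIntegral.integral_const_mul]
            ring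
    have hG := le_mul_exp_of_le_add_intervalIntegral hs₀b (hu.mono hsub) (hKc.mono_set hsub)
      hKc0 hlin s₀ ⟨le_rfl, hs₀b⟩
    have hKci : ∫ τ in s₀..b, (ψ τ + φ τ / (2 * c)) =
        (∫ τ in s₀..b, ψ τ) + (∫ τ in s₀..b, φ τ) / (2 * c) := by
      rw [integral_add (intervalIntegrable_of_integrableOn_Icc hψ hs₀.1 hs₀b le_rfl)
        ((intervalIntegrable_of_integrableOn_Icc hφ hs₀.1 hs₀b le_rfl).div_const _),
        intervalIntegral.integral_div]
    rwa [hKci] at hG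
  -- choice of the scale
  rcases eq_or_lt_of_le hP₀ with hP | hP
  · have h := key 1 one_pos
    rw [← hP] at h ⊢
    simp only [mul_zero, add_zero, zero_div] at h
    refine h.trans ?_
    nlinarith [Real.exp_pos (∫ τ in s₀..b, ψ τ)]
  · have h := key (∫ τ in s₀..b, φ τ) hP
    have h2 : (∫ τ in s₀..b, φ τ) / (2 * ∫ τ in s₀..b, φ τ) = 1 / 2 := by
      field_simp
    rw [h2, Real.exp_add] at h
    refine h.trans ?_
    have hE := Real.exp_pos (∫ τ in s₀..b, ψ τ)
    nlinarith [exp_half_le_two, mul_pos hE (Real.exp_pos (1 / 2 : ℝ)),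
      sq_nonneg (∫ τ in s₀..b, φ τ), mul_nonneg hΛ₀ hE.le,
      mul_nonneg (sq_nonneg (∫ τ in s₀..b, φ τ)) hE.le]

/-! ## §4. The differential form -/

/-- **Modified Gronwall lemma, differential form** (ABG Lemma 7.A.1 with θ = 1/2, weak form).
Let `F : ℝ → E` be continuous on `[a, b]` and differentiable on `(a, b)` with
`‖F' t‖ ≤ η t + φ t √‖F t‖ + ψ t ‖F t‖` there, where `η, φ, ψ ≥ 0` are integrable on `[a, b]`.
Then for every `s ∈ [a, b]`,
`‖F s‖ ≤ 2 (‖F b‖ + ∫_s^b η + (∫_s^b φ)²) · exp (∫_s^b ψ)`.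
Reduction to the integral form `le_of_le_add_intervalIntegral_sqrt` through
`‖F b - F s‖ ≤ ∫_s^b (η + φ √‖F‖ + ψ ‖F‖)` (displacement ≤ integral of the speed bound).
[cite: AmreinBoutetdeMonvelGeorgescu1996, Lemma 7.A.1] -/
theorem norm_le_of_norm_deriv_le_sqrt {E : Type*} [NormedAddCommGroup E] [NormedSpace ℝ E]
    {F F' : ℝ → E} {η φ ψ : ℝ → ℝ} {a b : ℝ} (hab : a ≤ b)
    (hF : ContinuousOn F (Icc a b)) (hF' : ∀ t ∈ Ioo a b, HasDerivAt F (F' t) t)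
    (hη : IntegrableOn η (Icc a b)) (hφ : IntegrableOn φ (Icc a b))
    (hψ : IntegrableOn ψ (Icc a b))
    (hη0 : ∀ t ∈ Icc a b, 0 ≤ η t) (hφ0 : ∀ t ∈ Icc a b, 0 ≤ φ t)
    (hψ0 : ∀ t ∈ Icc a b, 0 ≤ ψ t)
    (hbound : ∀ t ∈ Ioo a b, ‖F' t‖ ≤ η t + φ t * Real.sqrt ‖F t‖ + ψ t * ‖F t‖) :
    ∀ s ∈ Icc a b, ‖F s‖ ≤ 2 * (‖F b‖ + (∫ τ in s..b, η τ) + (∫ τ in s..b, φ τ) ^ 2) *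
      Real.exp (∫ τ in s..b, ψ τ) := by
  have hu : ContinuousOn (fun t => ‖F t‖) (Icc a b) := hF.norm
  refine le_of_le_add_intervalIntegral_sqrt hab hu (fun t _ => norm_nonneg _) hη hφ hψ hη0 hφ0
    hψ0 ?_
  intro s hs
  have hB : IntegrableOn (fun τ => η τ + φ τ * Real.sqrt ‖F τ‖ + ψ τ * ‖F τ‖) (Icc a b) :=
    (hη.add (hφ.mul_continuousOn hu.sqrt isCompact_Icc)).add
      (hψ.mul_continuousOn hu isCompact_Icc)
  have h1 : ‖F b - F s‖ ≤ ∫ τ in s..b, (η τ + φ τ * Real.sqrt ‖F τ‖ + ψ τ * ‖F τ‖) := by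
    refine norm_sub_le_integral_of_norm_deriv_le_of_le hs.2
      (hF.mono (Icc_subset_Icc_left hs.1))
      (fun t ht => (hF' t ⟨hs.1.trans_lt ht.1, ht.2⟩).differentiableAt.differentiableWithinAt)
      (Eventually.of_forall fun t ht => ?_)
      (intervalIntegrable_of_integrableOn_Icc hB hs.1 hs.2 le_rfl)
    rw [(hF' t ⟨hs.1.trans_lt ht.1, ht.2⟩).deriv]
    exact hbound t ⟨hs.1.trans_lt ht.1, ht.2⟩
  calc ‖F s‖ = ‖F b - (F b - F s)‖ := by rw [sub_sub_cancel]
    _ ≤ ‖F b‖ + ‖F b - F s‖ := norm_sub_le _ _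
    _ ≤ ‖F b‖ + ∫ τ in s..b, (η τ + φ τ * Real.sqrt ‖F τ‖ + ψ τ * ‖F τ‖) :=
        add_le_add le_rfl h1

/-! ## §5. Headline forms on `(0, ε₀]` (set integrals, all binders explicit) -/

/-- **Modified Gronwall lemma of Amrein–Boutet de Monvel–Georgescu (Lemma 7.A.1, θ = 1/2, weak
form (7.3.11)), headline form** (all binders explicit; registered helper stub F0 of
`stub_mourreThresholdLAP`). Let `F : ℝ → ℂ` be continuous on `(0, ε₀]` with derivative `F' ε`
at every `ε ∈ (0, ε₀)`, let `η, φ, ψ : ℝ → ℝ` be nonnegative and integrable on `(0, ε₀]`, and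
assume `‖F' ε‖ ≤ η ε + φ ε √‖F ε‖ + ψ ε ‖F ε‖` on `(0, ε₀)`. Then for every `ε ∈ (0, ε₀]`,
`‖F ε‖ ≤ 2 (‖F ε₀‖ + ∫_{(ε, ε₀]} η + (∫_{(ε, ε₀]} φ)²) · exp (∫_{(ε, ε₀]} ψ)`.
[cite: AmreinBoutetdeMonvelGeorgescu1996, Lemma 7.A.1] -/
theorem norm_le_sqrt_gronwall :
    ∀ (F F' : ℝ → ℂ) (η φ ψ : ℝ → ℝ) (ε₀ : ℝ),
      ContinuousOn F (Set.Ioc 0 ε₀) →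
      (∀ ε ∈ Set.Ioo 0 ε₀, HasDerivAt F (F' ε) ε) →
      MeasureTheory.IntegrableOn η (Set.Ioc 0 ε₀) MeasureTheory.volume →
      MeasureTheory.IntegrableOn φ (Set.Ioc 0 ε₀) MeasureTheory.volume →
      MeasureTheory.IntegrableOn ψ (Set.Ioc 0 ε₀) MeasureTheory.volume →
      (∀ ε ∈ Set.Ioc 0 ε₀, 0 ≤ η ε) → (∀ ε ∈ Set.Ioc 0 ε₀, 0 ≤ φ ε) →
      (∀ ε ∈ Set.Ioc 0 ε₀, 0 ≤ ψ ε) →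
      (∀ ε ∈ Set.Ioo 0 ε₀, ‖F' ε‖ ≤ η ε + φ ε * Real.sqrt ‖F ε‖ + ψ ε * ‖F ε‖) →
      ∀ ε ∈ Set.Ioc 0 ε₀, ‖F ε‖ ≤
        2 * (‖F ε₀‖
          + MeasureTheory.integral (MeasureTheory.volume.restrict (Set.Ioc ε ε₀)) (fun τ : ℝ => η τ)
          + (MeasureTheory.integral (MeasureTheory.volume.restrict (Set.Ioc ε ε₀))
              (fun τ : ℝ => φ τ)) ^ 2)
        * Real.exp (MeasureTheory.integral (MeasureTheory.volume.restrict (Set.Ioc ε ε₀))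
            (fun τ : ℝ => ψ τ)) := by
  intro F F' η φ ψ ε₀ hF hF' hη hφ hψ hη0 hφ0 hψ0 hbound ε hε
  have hsub : Icc ε ε₀ ⊆ Ioc 0 ε₀ := fun t ht => ⟨hε.1.trans_le ht.1, ht.2⟩
  have h := norm_le_of_norm_deriv_le_sqrt hε.2 (hF.mono hsub)
    (fun t ht => hF' t ⟨hε.1.trans ht.1, ht.2⟩) (hη.mono_set hsub) (hφ.mono_set hsub)
    (hψ.mono_set hsub) (fun t ht => hη0 t (hsub ht)) (fun t ht => hφ0 t (hsub ht))
    (fun t ht => hψ0 t (hsub ht)) (fun t ht => hbound t ⟨hε.1.trans ht.1, ht.2⟩) ε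
    ⟨le_rfl, hε.2⟩
  simpa only [intervalIntegral.integral_of_le hε.2] using h

/-- **Uniform form of the modified Gronwall lemma** (the `ε`-independent bound consumed by the
differential-inequality step of Mourre's method, ABG (7.3.11)–(7.3.12)): under the hypotheses of
`norm_le_sqrt_gronwall`, for every `ε ∈ (0, ε₀]`,
`‖F ε‖ ≤ 2 (‖F ε₀‖ + ∫_{(0, ε₀]} η + (∫_{(0, ε₀]} φ)²) · exp (∫_{(0, ε₀]} ψ)`,
a bound independent of `ε` (monotonicity of the integrals of the nonnegative `η, φ, ψ` in the
domain). [cite: AmreinBoutetdeMonvelGeorgescu1996, Lemma 7.A.1] -/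
theorem norm_le_sqrt_gronwall_uniform :
    ∀ (F F' : ℝ → ℂ) (η φ ψ : ℝ → ℝ) (ε₀ : ℝ),
      ContinuousOn F (Set.Ioc 0 ε₀) →
      (∀ ε ∈ Set.Ioo 0 ε₀, HasDerivAt F (F' ε) ε) →
      MeasureTheory.IntegrableOn η (Set.Ioc 0 ε₀) MeasureTheory.volume →
      MeasureTheory.IntegrableOn φ (Set.Ioc 0 ε₀) MeasureTheory.volume →
      MeasureTheory.IntegrableOn ψ (Set.Ioc 0 ε₀) MeasureTheory.volume →
      (∀ ε ∈ Set.Ioc 0 ε₀, 0 ≤ η ε) → (∀ ε ∈ Set.Ioc 0 ε₀, 0 ≤ φ ε) →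
      (∀ ε ∈ Set.Ioc 0 ε₀, 0 ≤ ψ ε) →
      (∀ ε ∈ Set.Ioo 0 ε₀, ‖F' ε‖ ≤ η ε + φ ε * Real.sqrt ‖F ε‖ + ψ ε * ‖F ε‖) →
      ∀ ε ∈ Set.Ioc 0 ε₀, ‖F ε‖ ≤
        2 * (‖F ε₀‖
          + MeasureTheory.integral (MeasureTheory.volume.restrict (Set.Ioc 0 ε₀)) (fun τ : ℝ => η τ)
          + (MeasureTheory.integral (MeasureTheory.volume.restrict (Set.Ioc 0 ε₀))
              (fun τ : ℝ => φ τ)) ^ 2)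
        * Real.exp (MeasureTheory.integral (MeasureTheory.volume.restrict (Set.Ioc 0 ε₀))
            (fun τ : ℝ => ψ τ)) := by
  intro F F' η φ ψ ε₀ hF hF' hη hφ hψ hη0 hφ0 hψ0 hbound ε hε
  have hmain := norm_le_sqrt_gronwall F F' η φ ψ ε₀ hF hF' hη hφ hψ hη0 hφ0 hψ0 hbound ε hε
  have hst : Ioc ε ε₀ ≤ᵐ[volume] Ioc 0 ε₀ := (Ioc_subset_Ioc_left hε.1.le).eventuallyLE
  have h1 : ∫ τ in Ioc ε ε₀, η τ ≤ ∫ τ in Ioc 0 ε₀, η τ :=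
    setIntegral_mono_set hη (ae_restrict_of_forall_mem measurableSet_Ioc hη0) hst
  have h2 : ∫ τ in Ioc ε ε₀, φ τ ≤ ∫ τ in Ioc 0 ε₀, φ τ :=
    setIntegral_mono_set hφ (ae_restrict_of_forall_mem measurableSet_Ioc hφ0) hst
  have h3 : ∫ τ in Ioc ε ε₀, ψ τ ≤ ∫ τ in Ioc 0 ε₀, ψ τ :=
    setIntegral_mono_set hψ (ae_restrict_of_forall_mem measurableSet_Ioc hψ0) hst
  have hX0 : 0 ≤ ∫ τ in Ioc ε ε₀, η τ :=
    setIntegral_nonneg measurableSet_Ioc fun τ hτ => hη0 τ ⟨hε.1.trans hτ.1, hτ.2⟩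
  have hP0 : 0 ≤ ∫ τ in Ioc ε ε₀, φ τ :=
    setIntegral_nonneg measurableSet_Ioc fun τ hτ => hφ0 τ ⟨hε.1.trans hτ.1, hτ.2⟩
  have h22 : (∫ τ in Ioc ε ε₀, φ τ) ^ 2 ≤ (∫ τ in Ioc 0 ε₀, φ τ) ^ 2 := pow_le_pow_left₀ hP0 h2 2
  refine hmain.trans (mul_le_mul ?_ (Real.exp_le_exp.2 h3) (Real.exp_pos _).le ?_)
  · linarith
  · have := norm_nonneg (F ε₀)
    nlinarith [sq_nonneg (∫ τ in Ioc 0 ε₀, φ τ)]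

end Summit.AtomisticToContinuum.FouriersLaw.Theorems.MourreDissolution
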